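import Literature.NumberTheory.EllipticCurves.PoonenRainsKummerIsotropy
import Literature.NumberTheory.GaloisRepresentations.GaloisCohomologyKummerProofs
import Mathlib.Tactic.LinearCombination
import HarnessLib

/-!
# Transport of the Poonen–Rains form along an affine identification of `2`-torsion (KMR Lemma 5.2)

Let `E, E'` be elliptic curves over `K` (models `W`, `W'`, `2 ≠ 0`) and `f : E'[2] → E[2]` a continuous
`Γ_K`-equivariant additive map sending the frame points `T'_j` to `T_{π j}` such that the `2`-torsion abscissae
are AFFINELY related over `K`: `x'_i − x'_j = A·(x_{πi} − x_{πj})`, `A ∈ K` (the situation of a quadratic twist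
`E' ≅ E^d`, where `x' = d u² x + r`).  Then the level-`2` theta data of `E` pulled back along `f` is the GAUGE
of the theta data of `E'` by the signs `ε_j = s'_j/(A s_{πj}) ∈ {±1}` (`m_transport`, `χ_transport`), so the
Poonen–Rains cocycles of `f ∘ ξ'` and `ξ'` differ by the coboundary of `ε ∘ ξ'` and

  `prClass W h2 L (H¹(f) x') = prClass W' h2 L x'`      (`prClass_map_eq`)

for every `K`-field `L` and `x' ∈ H¹(Γ_L, E'[2])`: the Tate quadratic forms of `E` and `E'` agree under
`E'[2] ≅ E[2]` (Klagsbrun–Mazur–Rubin 2013, Lemma 5.2, for quadratic twists).  References: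
[KlagsbrunMazurRubin2013] Lemma 5.2; [PoonenRains2012] §4.1, Prop. 4.9; [SilvermanAEC2009] X.§5
(twists).  No named fact is introduced.
-/

set_option autoImplicit false

noncomputable section

open scoped Classical ContRepresentation

namespace Literature.NumberTheory.EllipticCurves

namespace ThetaLevelTwo

open _root_.WeierstrassCurve Field
open Literature.Algebra.Homology
open Literature.NumberTheory.GaloisRepresentations Literature.NumberTheory.GaloisRepresentations.DiscreteGaloisModule
open Literature.NumberTheory.EllipticCurves.DokchitserDokchitser2012 (vec idx frame T xT permGal T_permGal smul_xT
  xT_injective coe_T_ne_zero eq_zero_or_eq_T T_injective)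

universe u

/-! ### Combinatorics of `Fin 3` and `𝔽₂²` -/

/-- An injective self-map of `Fin 3` maps the two other indices to the two other indices.
[cite: PoonenRains2012, §4.1 (the level-2 structure)] -/
theorem perm_succ_cases : ∀ (π : Fin 3 → Fin 3), Function.Injective π → ∀ j : Fin 3,
    (π (j + 1) = π j + 1 ∧ π (j + 2) = π j + 2) ∨ (π (j + 1) = π j + 2 ∧ π (j + 2) = π j + 1) := by
  decide

/-- An injective self-map of `Fin 3` respects the relation `vᵢ + vⱼ = v_k` of `𝔽₂²`.
[cite: PoonenRains2012, §4.1 (the level-2 structure)] -/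
theorem perm_vec_add : ∀ (π : Fin 3 → Fin 3), Function.Injective π → ∀ i j k : Fin 3,
    vec i + vec j = vec k → vec (π i) + vec (π j) = vec (π k) := by
  decide

/-- For `i ≠ j` in `Fin 3` the third index `k` has `vᵢ + vⱼ = v_k`. [cite: PoonenRains2012, §4.1 (the level-2 structure)] -/
theorem exists_third : ∀ i j : Fin 3, i ≠ j → ∃ k : Fin 3, vec i + vec j = vec k ∧ k ≠ i ∧ k ≠ j := by
  decide

variable {K : Type u} [Field K] (W W' : WeierstrassCurve K) [W.IsElliptic] [W'.IsElliptic] (h2 : (2 : K) ≠ 0)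

include h2 in
/-- `P + P = O` on `E[2]`. [cite: SilvermanAEC2009, III.§7 (E[2])] -/
theorem add_self_geomTorsion_two (P : geomTorsion W 2) : P + P = 0 :=
  (frame W h2).injective (by
    rw [map_add, map_zero]
    exact Prod.ext (CharTwo.add_self_eq_zero _) (CharTwo.add_self_eq_zero _))

/-- `Tᵢ + Tⱼ = T_k` when `vᵢ + vⱼ = v_k`. [cite: SilvermanAEC2009, III.§7 (E[2])] -/
theorem T_add_T {i j k : Fin 3} (hk : vec i + vec j = vec k) : T W h2 i + T W h2 j = T W h2 k :=
  (frame W h2).injective (by rw [map_add, frame_T, frame_T, frame_T, hk])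

section Transport

variable (f : (W'.torsionGaloisModule 2).toContRepresentation →ⁱL (W.torsionGaloisModule 2).toContRepresentation)
  (π : Fin 3 → Fin 3) (hπ : ∀ j, f (T W' h2 j) = T W h2 (π j))
  (A : K) (hx : ∀ i j, xT W' h2 i - xT W' h2 j
    = algebraMap K (AlgebraicClosure K) A * (xT W h2 (π i) - xT W h2 (π j)))

include hx in
/-- The index map is injective (the abscissae `x'_j` are distinct). [cite: SilvermanAEC2009, III.§7 (E[2])] -/
theorem π_injective : Function.Injective π := by
  intro i j hij
  by_contra h
  have := hx i j
  rw [hij, sub_self, mul_zero, sub_eq_zero] at this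
  exact h (xT_injective W' h2 this)

include hx in
/-- `A ≠ 0` in `K̄`. [cite: SilvermanAEC2009, III.§7 (E[2])] -/
theorem algebraMap_A_ne_zero : algebraMap K (AlgebraicClosure K) A ≠ 0 := by
  intro h
  have := hx 0 1
  rw [h, zero_mul, sub_eq_zero] at this
  exact absurd (xT_injective W' h2 this) (by decide)

include hx in
/-- **`D'_j = A² D_{πj}`** for the root discriminants `D_i = (x_i − x_{i+1})(x_i − x_{i+2})`.
[cite: PoonenRains2012, §4.1 (the level-2 structure)] -/
theorem D_transport (j : Fin 3) :
    (thetaData W' h2).D j = algebraMap K (AlgebraicClosure K) A ^ 2 * (thetaData W h2).D (π j) := by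
  have hinj := π_injective W W' h2 π A hx
  show (xT W' h2 j - xT W' h2 (j + 1)) * (xT W' h2 j - xT W' h2 (j + 2))
    = algebraMap K (AlgebraicClosure K) A ^ 2
      * ((xT W h2 (π j) - xT W h2 (π j + 1)) * (xT W h2 (π j) - xT W h2 (π j + 2)))
  rw [hx j (j + 1), hx j (j + 2)]
  rcases perm_succ_cases π hinj j with ⟨h1, h2'⟩ | ⟨h1, h2'⟩ <;> rw [h1, h2'] <;> ring

/-- The signs `ε_j = s'_j / (A s_{πj})`. [cite: KlagsbrunMazurRubin2013, Lemma 5.2 (the twisting isomorphism on the Heisenberg groups)] -/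
def eps (j : Fin 3) : AlgebraicClosure K :=
  (thetaData W' h2).s j / (algebraMap K (AlgebraicClosure K) A * (thetaData W h2).s (π j))

include hx in
/-- `s'_j = ε_j · A · s_{πj}`. [cite: KlagsbrunMazurRubin2013, Lemma 5.2 (the twisting isomorphism on the Heisenberg groups)] -/
theorem s_transport (j : Fin 3) :
    (thetaData W' h2).s j = eps W W' h2 π A j * algebraMap K (AlgebraicClosure K) A * (thetaData W h2).s (π j) := by
  have hA := algebraMap_A_ne_zero W W' h2 π A hx
  have hs := (thetaData W h2).s_ne_zero (π j)
  unfold eps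
  field_simp

include hx in
/-- `ε_j² = 1`. [cite: KlagsbrunMazurRubin2013, Lemma 5.2 (the twisting isomorphism on the Heisenberg groups)] -/
theorem eps_sq (j : Fin 3) : eps W W' h2 π A j ^ 2 = 1 := by
  have hA := algebraMap_A_ne_zero W W' h2 π A hx
  have hs := (thetaData W h2).s_ne_zero (π j)
  have h1 := (thetaData W' h2).s_sq j
  have h2' := (thetaData W h2).s_sq (π j)
  have hD := D_transport W W' h2 π A hx j
  unfold eps
  rw [div_pow, mul_pow, div_eq_one_iff_eq (mul_ne_zero (pow_ne_zero 2 hA) (pow_ne_zero 2 hs)), h1, h2']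
  show -(thetaData W' h2).D j = _ * -(thetaData W h2).D (π j)
  rw [hD]; ring

include hx in
/-- `ε_j ≠ 0`. [cite: KlagsbrunMazurRubin2013, Lemma 5.2 (the twisting isomorphism on the Heisenberg groups)] -/
theorem eps_ne_zero (j : Fin 3) : eps W W' h2 π A j ≠ 0 := fun h => by
  have := eps_sq W W' h2 π A hx j
  rw [h, zero_pow two_ne_zero] at this
  exact zero_ne_one this

/-- The sign function on the frame: `ε(O) = 1`, `ε(vⱼ) = ε_j`. [cite: KlagsbrunMazurRubin2013, Lemma 5.2 (the twisting isomorphism on the Heisenberg groups)] -/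
def epsV (v : V) : AlgebraicClosure K := if v = 0 then 1 else eps W W' h2 π A (idx v)

include hx in
/-- `ε(v)² = 1`. [cite: KlagsbrunMazurRubin2013, Lemma 5.2 (the twisting isomorphism on the Heisenberg groups)] -/
theorem epsV_sq (v : V) : epsV W W' h2 π A v ^ 2 = 1 := by
  unfold epsV; split_ifs
  · exact one_pow 2
  · exact eps_sq W W' h2 π A hx _

include hx in
/-- `ε(v) ≠ 0`. [cite: KlagsbrunMazurRubin2013, Lemma 5.2 (the twisting isomorphism on the Heisenberg groups)] -/
theorem epsV_ne_zero (v : V) : epsV W W' h2 π A v ≠ 0 := fun h => by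
  have := epsV_sq W W' h2 π A hx v
  rw [h, zero_pow two_ne_zero] at this
  exact zero_ne_one this

/-- `ε(O) = 1`. [cite: KlagsbrunMazurRubin2013, Lemma 5.2 (the twisting isomorphism on the Heisenberg groups)] -/
@[simp] theorem epsV_zero : epsV W W' h2 π A 0 = 1 := by simp [epsV]

/-- `ε(vⱼ) = ε_j`. [cite: KlagsbrunMazurRubin2013, Lemma 5.2 (the twisting isomorphism on the Heisenberg groups)] -/
@[simp] theorem epsV_vec (j : Fin 3) : epsV W W' h2 π A (vec j) = eps W W' h2 π A j := by
  have hidx : idx (vec j) = j := by fin_cases j <;> decide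
  simp [epsV, hidx, show vec j ≠ 0 by fin_cases j <;> decide]

/-- **The gauge** `λ : E'[2] → μ₂(K̄)`, `λ(P') = ε(frame' P')`. [cite: KlagsbrunMazurRubin2013, Lemma 5.2 (the twisting isomorphism on the Heisenberg groups)] -/
def lam (hx : ∀ i j, xT W' h2 i - xT W' h2 j
    = algebraMap K (AlgebraicClosure K) A * (xT W h2 (π i) - xT W h2 (π j))) (P : geomTorsion W' 2) : MuCarrier K 2 :=
  MuCarrier.ofRootsOfUnity ⟨Units.mk0 (epsV W W' h2 π A (frame W' h2 P)) (epsV_ne_zero W W' h2 π A hx _), by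
    rw [mem_rootsOfUnity]; apply Units.ext
    rw [Units.val_pow_eq_pow_val, Units.val_mk0, Units.val_one]; exact epsV_sq W W' h2 π A hx _⟩

/-- `λ(P')` read in `K̄`: `ε(frame' P')`. [cite: KlagsbrunMazurRubin2013, Lemma 5.2 (the twisting isomorphism on the Heisenberg groups)] -/
@[simp] theorem coe_muVal_lam (P : geomTorsion W' 2) :
    ((muVal K 2 (lam W W' h2 π A hx P) : (AlgebraicClosure K)ˣ) : AlgebraicClosure K) = epsV W W' h2 π A (frame W' h2 P) :=
  rfl

/-- `λ(O) = 0`. [cite: KlagsbrunMazurRubin2013, Lemma 5.2 (the twisting isomorphism on the Heisenberg groups)] -/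
theorem lam_zero : lam W W' h2 π A hx 0 = 0 := by
  apply muVal_injective K 2
  apply Units.ext
  rw [coe_muVal_lam, map_zero, epsV_zero, muVal_zero, Units.val_one]

/-! ### The frame along `f` -/

include hπ in
/-- `f(O) = O` and `frame (f T'_j) = v_{πj}`. [cite: SilvermanAEC2009, III.§7 (E[2])] -/
theorem frame_f_T (j : Fin 3) : frame W h2 (f (T W' h2 j)) = vec (π j) := by
  rw [hπ, frame_T]

include hπ in
/-- **Equivariance in indices**: `π(σ·j) = σ·(πj)` (`f` is `Γ_K`-equivariant). [cite: SilvermanAEC2009, III.§7 (the representation on E[2])] -/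
theorem π_permGal (σ : absoluteGaloisGroup K) (j : Fin 3) : π (permGal W' h2 σ j) = permGal W h2 σ (π j) := by
  apply T_injective W h2
  rw [← hπ, T_permGal, T_permGal, ← hπ]
  have h := DFunLike.congr_fun (f.isIntertwining' σ) (T W' h2 j)
  simp only [ContinuousLinearMap.coe_comp, Function.comp_apply] at h
  exact h

omit [W.IsElliptic] [W'.IsElliptic] in
/-- `f(σ P') = σ f(P')`. [cite: SilvermanAEC2009, III.§7 (the representation on E[2])] -/
theorem f_smul (σ : absoluteGaloisGroup K) (P : geomTorsion W' 2) : f (σ • P) = σ • f P := by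
  have h := DFunLike.congr_fun (f.isIntertwining' σ) P
  simp only [ContinuousLinearMap.coe_comp, Function.comp_apply] at h
  exact h

/-! ### Reading `heisenbergMu` in `K̄` -/

omit [W'.IsElliptic] in
/-- `m_μ` read in `K̄` is `m_{Gm}`. [cite: PoonenRains2012, Prop. 4.5 (the Heisenberg group)] -/
theorem coe_muVal_heisenbergMu_m (P Q : geomTorsion W 2) :
    ((muVal K 2 ((heisenbergMu W h2).m P Q) : (AlgebraicClosure K)ˣ) : AlgebraicClosure K)
      = ((Additive.toMul ((heisenbergGm W h2).m P Q) : (AlgebraicClosure K)ˣ) : AlgebraicClosure K) := by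
  show (((Additive.toMul (MuCarrier.toAdditive ((heisenbergMu W h2).m P Q)) : rootsOfUnity 2 (AlgebraicClosure K))
    : (AlgebraicClosure K)ˣ) : AlgebraicClosure K) = _
  simp only [heisenbergMu, HeisenbergDatum.mapValues_m, coe_muTwoToCarrier, HeisenbergDatum.coe_codRestrict_m]

omit [W'.IsElliptic] in
/-- `χ_μ` read in `K̄` is `χ_{Gm}`. [cite: PoonenRains2012, Prop. 4.5 (the Heisenberg group)] -/
theorem coe_muVal_heisenbergMu_χ (σ : absoluteGaloisGroup K) (P : geomTorsion W 2) :
    ((muVal K 2 ((heisenbergMu W h2).χ σ P) : (AlgebraicClosure K)ˣ) : AlgebraicClosure K)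
      = ((Additive.toMul ((heisenbergGm W h2).χ σ P) : (AlgebraicClosure K)ˣ) : AlgebraicClosure K) := by
  show (((Additive.toMul (MuCarrier.toAdditive ((heisenbergMu W h2).χ σ P)) : rootsOfUnity 2 (AlgebraicClosure K))
    : (AlgebraicClosure K)ˣ) : AlgebraicClosure K) = _
  simp only [heisenbergMu, HeisenbergDatum.mapValues_χ, coe_muTwoToCarrier, HeisenbergDatum.coe_codRestrict_χ]

omit [W.IsElliptic] [W'.IsElliptic] in
/-- `muAction σ z` read in `K̄` is `σ` applied to `z`. [cite: SerreGaloisCohomology1997, II §1.2 (μₙ as a Galois module)] -/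
theorem coe_muVal_muAction (σ : absoluteGaloisGroup K) (z : MuCarrier K 2) :
    ((muVal K 2 (muAction σ z) : (AlgebraicClosure K)ˣ) : AlgebraicClosure K)
      = σ • ((muVal K 2 z : (AlgebraicClosure K)ˣ) : AlgebraicClosure K) := by
  rw [muAction_apply, muVal_apply, Units.coe_smul]

include hx in
/-- `ε_j = 1 ∨ ε_j = −1`. [cite: KlagsbrunMazurRubin2013, Lemma 5.2 (the twisting isomorphism on the Heisenberg groups)] -/
theorem eps_eq_one_or (j : Fin 3) : eps W W' h2 π A j = 1 ∨ eps W W' h2 π A j = -1 :=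
  mul_self_eq_one_iff.mp (by rw [← pow_two]; exact eps_sq W W' h2 π A hx j)

omit [W.IsElliptic] [W'.IsElliptic] in
/-- `σ` fixes `±1`. [cite: SerreGaloisCohomology1997, II §1.2 (μₙ as a Galois module)] -/
theorem smul_of_sq_one (σ : absoluteGaloisGroup K) {e : AlgebraicClosure K} (he : e = 1 ∨ e = -1) : σ • e = e := by
  rcases he with rfl | rfl
  · exact smul_one σ
  · rw [smul_neg, smul_one]

omit [W.IsElliptic] [W'.IsElliptic] in
/-- `σ` fixes `A ∈ K`. [cite: SilvermanAEC2009, VIII.§1 (Galois acts trivially on K)] -/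
theorem smul_algebraMap_A (σ : absoluteGaloisGroup K) :
    σ • algebraMap K (AlgebraicClosure K) A = algebraMap K (AlgebraicClosure K) A :=
  (show AlgebraicClosure K ≃ₐ[K] AlgebraicClosure K from σ).commutes A

/-! ### The two transport identities -/

include hπ hx in
/-- **(M) The cocycles `m` agree up to the gauge `λ`**: `m_E(fP, fQ) = m_{E'}(P, Q) + λP + λQ − λ(P+Q)`.
[cite: KlagsbrunMazurRubin2013, Lemma 5.2 (the twisting isomorphism on the Heisenberg groups)] -/
theorem m_transport (P Q : geomTorsion W' 2) :
    (heisenbergMu W h2).m (f P) (f Q)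
      = (heisenbergMu W' h2).m P Q + lam W W' h2 π A hx P + lam W W' h2 π A hx Q - lam W W' h2 π A hx (P + Q) := by
  have hinj := π_injective W W' h2 π A hx
  have hA := algebraMap_A_ne_zero W W' h2 π A hx
  rcases eq_zero_or_eq_T W' h2 P with rfl | ⟨i, rfl⟩
  · rw [map_zero, (heisenbergMu W h2).m_zero_left, (heisenbergMu W' h2).m_zero_left, lam_zero, zero_add, zero_add,
      zero_add, sub_self]
  rcases eq_zero_or_eq_T W' h2 Q with rfl | ⟨j, rfl⟩
  · rw [map_zero, (heisenbergMu W h2).m_zero_right, (heisenbergMu W' h2).m_zero_right, lam_zero, add_zero, zero_add,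
      add_zero, sub_self]
  apply muVal_injective K 2
  apply Units.ext
  rw [muVal_sub, muVal_add, muVal_add, Units.val_div_eq_div_val, Units.val_mul, Units.val_mul,
    coe_muVal_heisenbergMu_m, coe_muVal_heisenbergMu_m, coe_muVal_lam, coe_muVal_lam, coe_muVal_lam, frame_T, frame_T,
    epsV_vec, epsV_vec]
  by_cases hij : i = j
  · subst hij
    rw [add_self_geomTorsion_two W' h2, map_zero, epsV_zero, div_one, hπ,
      coe_toMul_m_self W h2 (fun h => coe_T_ne_zero W h2 (π i) (by rw [h, ZeroMemClass.coe_zero])),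
      coe_toMul_m_self W' h2 (fun h => coe_T_ne_zero W' h2 i (by rw [h, ZeroMemClass.coe_zero]))]
    rcases eps_eq_one_or W W' h2 π A hx i with h | h <;> simp [h]
  obtain ⟨k, hk, hki, hkj⟩ := exists_third i j hij
  have hk' : vec (π i) + vec (π j) = vec (π k) := perm_vec_add π hinj i j k hk
  rw [T_add_T W' h2 hk, frame_T, epsV_vec, hπ, hπ, heisenbergGm_m, heisenbergGm_m, frame_T, frame_T, frame_T, frame_T,
    (thetaData W h2).coe_toMul_thetaDatum_m_vec_vec (hinj.ne hij) hk',
    (thetaData W' h2).coe_toMul_thetaDatum_m_vec_vec hij hk]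
  show (xT W h2 (π i) - xT W h2 (π j))⁻¹ * (thetaData W h2).s (π i) * (thetaData W h2).s (π j) / (thetaData W h2).s (π k)
    = (xT W' h2 i - xT W' h2 j)⁻¹ * (thetaData W' h2).s i * (thetaData W' h2).s j / (thetaData W' h2).s k
      * eps W W' h2 π A i * eps W W' h2 π A j / eps W W' h2 π A k
  rw [hx i j, s_transport W W' h2 π A hx i, s_transport W W' h2 π A hx j, s_transport W W' h2 π A hx k]
  have hΔ : xT W h2 (π i) - xT W h2 (π j) ≠ 0 := sub_ne_zero.mpr fun h => hinj.ne hij (xT_injective W h2 h)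
  have hs := (thetaData W h2).s_ne_zero (π k)
  rcases eps_eq_one_or W W' h2 π A hx i with hi | hi <;> rcases eps_eq_one_or W W' h2 π A hx j with hj | hj <;>
    rcases eps_eq_one_or W W' h2 π A hx k with hk2 | hk2 <;> rw [hi, hj, hk2] <;> field_simp

include hπ hx in
/-- **(X) The correction terms `χ` agree up to the gauge `λ`**: `χ_E(σ)(fP) = χ_{E'}(σ)(P) + σλ(P) − λ(σP)`.
[cite: KlagsbrunMazurRubin2013, Lemma 5.2 (the twisting isomorphism on the Heisenberg groups)] -/
theorem χ_transport (σ : absoluteGaloisGroup K) (P : geomTorsion W' 2) :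
    (heisenbergMu W h2).χ σ (f P)
      = (heisenbergMu W' h2).χ σ P + muAction σ (lam W W' h2 π A hx P) - lam W W' h2 π A hx (σ • P) := by
  have hA := algebraMap_A_ne_zero W W' h2 π A hx
  rcases eq_zero_or_eq_T W' h2 P with rfl | ⟨j, rfl⟩
  · rw [map_zero, smul_zero, (heisenbergMu W h2).χ_zero, (heisenbergMu W' h2).χ_zero, lam_zero, map_zero, zero_add,
      sub_self]
  apply muVal_injective K 2
  apply Units.ext
  rw [muVal_sub, muVal_add, Units.val_div_eq_div_val, Units.val_mul, coe_muVal_heisenbergMu_χ, coe_muVal_heisenbergMu_χ,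
    coe_muVal_muAction, coe_muVal_lam, coe_muVal_lam, hπ, heisenbergGm_χ, heisenbergGm_χ, frame_T, frame_T, epsV_vec,
    ← T_permGal, frame_T, epsV_vec, (thetaData W h2).toMul_thetaDatum_χ, (thetaData W' h2).toMul_thetaDatum_χ,
    Units.val_div_eq_div_val, Units.val_div_eq_div_val, ThetaData.coe_toMul_unitsAction, ThetaData.coe_toMul_unitsAction,
    toMul_ofMul, toMul_ofMul, ThetaData.coe_sUnit_vec, ThetaData.coe_sUnit_vec]
  show σ • (thetaData W h2).s (π j) / ((thetaData W h2).sUnit (frameAction W h2 σ (vec (π j))) : AlgebraicClosure K)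
    = σ • (thetaData W' h2).s j / ((thetaData W' h2).sUnit (frameAction W' h2 σ (vec j)) : AlgebraicClosure K)
      * (σ • eps W W' h2 π A j) / eps W W' h2 π A (permGal W' h2 σ j)
  rw [frameAction_vec, frameAction_vec, ThetaData.coe_sUnit_vec, ThetaData.coe_sUnit_vec,
    ← π_permGal W W' h2 f π hπ σ j, s_transport W W' h2 π A hx j, s_transport W W' h2 π A hx (permGal W' h2 σ j),
    smul_mul', smul_mul', smul_algebraMap_A, smul_of_sq_one σ (eps_eq_one_or W W' h2 π A hx j)]
  have hs := (thetaData W h2).s_ne_zero (π (permGal W' h2 σ j))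
  rcases eps_eq_one_or W W' h2 π A hx j with hj | hj <;>
    rcases eps_eq_one_or W W' h2 π A hx (permGal W' h2 σ j) with hk | hk <;> rw [hj, hk] <;> field_simp

/-! ### Transport of the Poonen–Rains cocycle and class -/

variable (L : Type u) [Field L] [Algebra K L]

/-- The pushed-forward crossed homomorphism `f ∘ ξ'` over `Γ_L`. [cite: SerreGaloisCohomology1997, I §2.4 (compatible pairs)] -/
def pushCocycle (ξ' : contOneCocycles (DiscreteGaloisModule.toTopRep (GaloisRep.restrictField L (W'.torsionGaloisModule 2)))) :
    contOneCocycles (DiscreteGaloisModule.toTopRep (GaloisRep.restrictField L (W.torsionGaloisModule 2))) :=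
  contOneCocycles.pullback (ContinuousMonoidHom.id (absoluteGaloisGroup L))
    (X := DiscreteGaloisModule.toTopRep (GaloisRep.restrictField L (W'.torsionGaloisModule 2)))
    (Y := DiscreteGaloisModule.toTopRep (GaloisRep.restrictField L (W.torsionGaloisModule 2)))
    (TopRep.ofHom ⟨(f.restrictField L).toContinuousLinearMap, (f.restrictField L).isIntertwining'⟩) ξ'

omit [W.IsElliptic] [W'.IsElliptic] in
/-- Values of `pushCocycle`: `(f ∘ ξ')(σ) = f(ξ'_σ)`. [cite: SerreGaloisCohomology1997, I §2.4 (compatible pairs)] -/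
@[simp] theorem pushCocycle_apply
    (ξ' : contOneCocycles (DiscreteGaloisModule.toTopRep (GaloisRep.restrictField L (W'.torsionGaloisModule 2))))
    (σ : absoluteGaloisGroup L) : (pushCocycle W W' f L ξ').1 σ = f (ξ'.1 σ) := rfl

omit [W.IsElliptic] [W'.IsElliptic] in
/-- `H¹(f|_L)[ξ'] = [f ∘ ξ']`. [cite: SerreGaloisCohomology1997, I §2.4 (compatible pairs)] -/
theorem map_restrictField_oneCocycleClass
    (ξ' : contOneCocycles (DiscreteGaloisModule.toTopRep (GaloisRep.restrictField L (W'.torsionGaloisModule 2)))) :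
    galoisCohomology.map (f.restrictField L) 1 (oneCocycleClass _ ξ') = oneCocycleClass _ (pushCocycle W W' f L ξ') :=
  galoisCohomology.map_one_oneCocycleClass (f.restrictField L) ξ'

include hπ hx in
/-- **The Poonen–Rains cocycles of `f ∘ ξ'` and `ξ'` differ by the coboundary of `λ ∘ ξ'`.**
[cite: KlagsbrunMazurRubin2013, Lemma 5.2 (the Tate quadratic forms of E and E^χ agree)] -/
theorem prCocycle_push_apply
    (ξ' : contOneCocycles (DiscreteGaloisModule.toTopRep (GaloisRep.restrictField L (W'.torsionGaloisModule 2))))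
    (σ τ : absoluteGaloisGroup L) :
    (prCocycle W h2 L (pushCocycle W W' f L ξ')).1 (σ, τ)
      = (prCocycle W' h2 L ξ').1 (σ, τ)
        + ((DiscreteGaloisModule.toTopRep (GaloisRep.restrictField L (mu K 2))).ρ σ (lam W W' h2 π A hx (ξ'.1 τ))
            - lam W W' h2 π A hx (ξ'.1 (σ * τ)) + lam W W' h2 π A hx (ξ'.1 σ)) := by
  have hξ' : (ξ'.1 (σ * τ) : geomTorsion W' 2) = ξ'.1 σ + absGaloisRestrict K L σ • ξ'.1 τ :=
    isCrossedHom_of_mem W' h2 L ξ' σ τ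
  have hθ : ∀ g, (absGaloisRestrict K L : absoluteGaloisGroup L →ₜ* absoluteGaloisGroup K).toMonoidHom g
      = absGaloisRestrict K L g := fun _ => rfl
  rw [prCocycle_apply, prCocycle_apply, HeisenbergDatum.conn_apply, HeisenbergDatum.conn_apply, cocycleFun_apply,
    cocycleFun_apply, cocycleFun_apply, cocycleFun_apply, pushCocycle_apply, pushCocycle_apply, localDatum_ρ_apply,
    localDatum_ρ_apply, toTopRep_mu_ρ_apply]
  simp only [localDatum, HeisenbergDatum.comap_χ, HeisenbergDatum.comap_m, hθ]
  rw [← f_smul W W' f, m_transport W W' h2 f π hπ A hx, χ_transport W W' h2 f π hπ A hx, hξ', muAction_apply]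
  abel

include hπ hx in
/-- **Transport of the Poonen–Rains form (Klagsbrun–Mazur–Rubin 2013, Lemma 5.2, explicit form).**  For a
`Γ_K`-equivariant `f : E'[2] → E[2]` matching the frames with affinely related abscissae
(`x'_i − x'_j = A(x_{πi} − x_{πj})`, `A ∈ K`), the Poonen–Rains quadratic maps agree:
`q_{E,L}(H¹(f) x') = q_{E',L}(x')` for every `K`-field `L` and `x' ∈ H¹(Γ_L, E'[2])`.
[cite: KlagsbrunMazurRubin2013, Lemma 5.2 (the Tate quadratic forms of E and E^χ agree)] -/
theorem prClass_map_eq (x' : galoisCohomology (GaloisRep.restrictField L (W'.torsionGaloisModule 2)) 1) :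
    prClass W h2 L (galoisCohomology.map (f.restrictField L) 1 x') = prClass W' h2 L x' := by
  haveI : CompactSpace (absoluteGaloisGroup L) := absoluteGaloisGroup_compactSpace L
  obtain ⟨ξ', rfl⟩ := oneCocycleClass_surjective _ x'
  rw [map_restrictField_oneCocycleClass, prClass_oneCocycleClass, prClass_oneCocycleClass]
  have key : twoCocycleClass _ (prCocycle W h2 L (pushCocycle W W' f L ξ') - prCocycle W' h2 L ξ') = 0 := by
    have hb : Continuous (fun σ => lam W W' h2 π A hx (cocycleFun W' L ξ' σ)) :=
      (continuous_of_discreteTopology (f := lam W W' h2 π A hx)).comp (continuous_cocycleFun W' L ξ')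
    refine (twoCocycleClass_eq_zero_iff _ _).mpr ⟨⟨fun σ => lam W W' h2 π A hx (ξ'.1 σ), hb⟩, fun σ τ => ?_⟩
    rw [Submodule.coe_sub, ContinuousMap.sub_apply, prCocycle_push_apply W W' h2 f π hπ A hx L ξ' σ τ]
    show _ = (DiscreteGaloisModule.toTopRep (GaloisRep.restrictField L (mu K 2))).ρ σ (lam W W' h2 π A hx (ξ'.1 τ))
      - lam W W' h2 π A hx (ξ'.1 (σ * τ)) + lam W W' h2 π A hx (ξ'.1 σ)
    abel
  rw [twoCocycleClass_sub, sub_eq_zero] at key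
  exact key

end Transport

end ThetaLevelTwo

end Literature.NumberTheory.EllipticCurves
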